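import Summits.HodgeConjecture.CorCM.QuarticCMTypePairNondegenerate
import Summits.HodgeConjecture.CorCM.CyclicSexticCMTypeSliceOfMarkman
import Summits.HodgeConjecture.CorCM.ShimuraIsogenousPowerHolds
import Literature.AlgebraicGeometry.ComplexMultiplication.CMTypeConjugateIsogeny
import Literature.AlgebraicGeometry.Pohlmann1968.NondegenerateCMTypeFamilies
import HarnessLib

/-!
# The QUARTIC slice of `HC_CM`, unconditionally: CM inside a quartic CM field without imaginary quadratic subfield

COR-CM (cell `pub-hodgecm2`), seat b24, count-neutral lane QUARTIC-SLICE, part III (sequel of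
`CorCM/QuarticCMTypeReflection.lean`, `CorCM/QuarticCMTypePairNondegenerate.lean`).  Everything is PROVED; theorems only;
no definition; NO named fact is displayed — Riemann's theorem, the CM realisation record and Shimura's isogeny
theorems are the tree's theorems (`deligneMilne1982_Thm_6_20_full_holds`, `cmAbelianVarietyRealised_holds`,
`shimura1998_Thm3_isogenousPower_and_Thm2_cor`).

`K` a quartic CM field whose automorphism group is CYCLIC — i.e. `K/ℚ` non-Galois (`Aut(K) = {1, c}`, dihedral normal
closure) or cyclic Galois; equivalently `K` is not biquadratic, equivalently `K` has no imaginary quadratic subfield,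
equivalently every CM type of `K` is primitive (its CM abelian surfaces are simple).

* §1 `AVDominatedBy.biproduct_map` — domination factor by factor: `A_j ≼ P_j` for all `j` ⟹ `⨁ A_j ≼ ⨁ P_j`.
* §2 the chosen realisations `A_{(K,Φ)} = (cmRealisation h₃ (cmCode K Φ)).AV`: every realisation of `Φ` is dominated by
  `A_{(K,Φ)}` (Shimura §6.1 Cor.), `A_{(K,Φ̄)} ≼ A_{(K,Φ)}` (Deligne's twist by `c`), `A_{(K,Φ)} ≼ A_{(K,Φ^e)}`
  (twist by `e ∈ Aut K`, `IsCMTypeRealisation.transport`).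
  `hodgeConjectureFor_cmProdAV_of_pair` — with `Θ 0 = {a, b}`, `Ψ = {a, b̄}` every `Θ j ∈ {Θ 0, \overline{Θ 0}, Ψ, Ψ̄}`
  (`type_eq_or_eq_or_eq_or_eq`), so `∏_j A_{(K,Θ_j)} ≼ ⨁_j A_{c j}` for the reference pair `(A_{Θ 0}, A_Ψ)`: HC for the
  products of the reference pair gives HC for `∏_j A_{(K,Θ_j)}`.
* §3 **`hodgeConjectureFor_cmProdAV_of_not_isGalois`** — `K/ℚ` NOT Galois: the reference family `(Θ 0, Ψ)` is
  NONDEGENERATE (`isNondegenerateFamily_pair_of_not_isGalois`), so its products satisfy HC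
  (`Pohlmann1968.IsNondegenerateFamily.hodgeConjectureFor_prod`).
* §4 `K/ℚ` Galois with cyclic group: every embedding is `a ∘ w`, `w ∈ Gal` (`exists_eq_comp_algEquiv`); for `b = a ∘ g`,
  `g ∉ {1, c}`, one has `g² = c` (`mul_self_eq_conjGal_of_isCyclic`); an automorphism of `ℂ` with `a ↦ b` is then a
  four-cycle (`b ↦ ā`), so `Θ 0` is primitive, hence nondegenerate (Ribet); and with `Ψ = {a, b̄}` the twisted type
  `Ψ^{gc} ⊇ {b̄, a}` equals `Θ 0` (`cmType_eq_of_subset`), so `A_Ψ ≼ A_{Θ 0}`, `A_{Ψ̄} ≼ A_Ψ`, `A_{\overline{Θ 0}} ≼ A_{Θ 0}` and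
  `∏_j A_{(K,Θ_j)} ≼ A_{Θ 0}^{n+1}`, which satisfies HC (`Pohlmann1968.IsNondegenerate.hodgeConjectureFor_pow`):
  **`hodgeConjectureFor_cmProdAV_of_isGalois_of_isCyclic`**.
* §5 **`hodgeConjectureFor_cmProdAV_quartic_of_isCyclic`** (`IsCyclic (K ≃ₐ[ℚ] K)`),
  **`hodgeConjectureFor_of_avDominatedBy_cmProdAV_of_isCyclic`**,
  **`hodgeConjectureFor_of_isOfCMType_of_endAlgebra_quartic_of_isCyclic`** (every complex abelian variety of CM type whose
  simple abelian subvarieties have `End⁰ →+* K`: seat b30's record-free domination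
  `CyclicSextic.exists_avDominatedBy_cmProdAV_of_isOfCMType_of_endAlgebra`) and
  **`cmAbelianHodge_slice_quartic_of_isCyclic`** — the binders of `Theses.RankFourFaces.CMAbelianHodge` verbatim, NO
  hypothesis beyond `[K:ℚ] = 4 ∧ Aut(K)` cyclic.

Scope: the biquadratic quartic CM fields (`Aut(K)` the Klein group; CM types induced from the two imaginary quadratic
subfields) are the sequel `CorCM/QuarticCMTypeSliceBiquadratic.lean`, which removes the hypothesis `Aut(K)` cyclic.  Print
counterpart: Moonen–Zarhin 1999 (simple CM abelian surfaces: `Hg = U_K`; `X₁ ≁ X₂ ⟹ Hg(X₁ × X₂) = Hg(X₁) × Hg(X₂)`) with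
Hazama–Murty (Gordon 7.5: `rank Hg = rdim ⟹ Hdg = Div` on all products) — i.e. a known case of the Hodge conjecture,
here a kernel theorem in `HC_CM`'s own binder language.

## References
* [MoonenZarhin1999LowDim] B. Moonen, Yu. Zarhin, Math. Ann. 315 (1999) 711–733, section "Hodge groups of simple
  abelian surfaces of CM-type".
* [Gordon1999HodgeAVSurvey] B. B. Gordon, *A survey of the Hodge conjecture for abelian varieties*, 7.5, 10.10.
* [Shimura1998] G. Shimura, *Abelian Varieties with Complex Multiplication and Modular Functions*, §6.1 Cor. of Thm. 2,
  §6.2 Thm. 3, §8.2 Prop. 26.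
* [Deligne1982HodgeCycles] P. Deligne, LNM 900 (1982), §5 (b).
* [MumfordAV1970] D. Mumford, *Abelian Varieties*, §19.
-/

noncomputable section

open CategoryTheory CategoryTheory.Limits NumberField NumberField.ComplexEmbedding AlgebraicGeometry
open Literature.AlgebraicGeometry Literature.AlgebraicGeometry.Motives Literature.AlgebraicGeometry.HodgeTheory
open Literature.AlgebraicGeometry.ComplexMultiplication Literature.AlgebraicGeometry.Milne1999
open Literature.AlgebraicGeometry.Pohlmann1968
open Literature.NumberTheory.ComplexMultiplication
open Literature.NumberTheory.ComplexMultiplication.CMTypeOps (bar mem_bar_iff conjugate_mem_iff_notMem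
  mem_iff_conjugate_notMem)
open Literature.NumberTheory.Automorphic.PicardCM (cmRealisation CMAbelianVarietyRealised)
open Literature.NumberTheory.Automorphic.PicardCM.CMCode (cmTypeMap mem_cmTypeMap_iff)
open Summit.HodgeConjecture.CorCM.Domination
open Summit.HodgeConjecture.CorCM.CyclicSextic (conjugate_eq_comp_conjGal orderOf_conjGal
  exists_avDominatedBy_cmProdAV_of_isOfCMType_of_endAlgebra)

/-! ## §1 Domination factor by factor -/

namespace Summit.HodgeConjecture.CorCM.Domination.AVDominatedBy

/-- **Domination factor by factor**: if `A_j` is `N_j`-dominated by `P_j` for every `j`, then `⨁_j A_j` is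
`(∏_j N_j)`-dominated by `⨁_j P_j` (rescale the `j`-th section by `∏_{i ≠ j} N_i`). [cite: MumfordAV1970, §19] -/
theorem biproduct_map {J : Type} [Fintype J] {A P : J → AbelianVariety ℂ} (h : ∀ j, AVDominatedBy (A j) (P j)) :
    AVDominatedBy (⨁ A) (⨁ P) := by
  classical
  choose s π N hN hsπ using h
  refine ⟨Limits.biproduct.map fun j => (∏ i ∈ Finset.univ.erase j, N i) • s j, Limits.biproduct.map π, ∏ i, N i,
    Finset.prod_ne_zero_iff.2 fun i _ => hN i, ?_⟩
  refine Limits.biproduct.hom_ext _ _ fun j => ?_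
  rw [Category.assoc, Limits.biproduct.map_π, ← Category.assoc, Limits.biproduct.map_π, Category.assoc,
    Preadditive.nsmul_comp, hsπ, smul_smul, Finset.prod_erase_mul _ _ (Finset.mem_univ j), Preadditive.comp_nsmul,
    Category.comp_id, Preadditive.nsmul_comp, Category.id_comp]

end Summit.HodgeConjecture.CorCM.Domination.AVDominatedBy

namespace Summit.HodgeConjecture.CorCM.QuarticCM

variable {K : Type} [Field K] [NumberField K] [IsCMField K]

/-! ## §2 The chosen realisations `A_{(K,Φ)}`: same type, conjugate type, twisted type -/

/-- **Every realisation of `(K; Φ)` is dominated by the chosen one `A_{(K,Φ)}`** (Shimura §6.1 Corollary: two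
realisations of one CM type are isogenous; the tree's `avDominatedBy_cmProdAV_zero_of_isCMTypeRealisation` at the
discharged records `shimura1998_Thm3_isogenousPower_and_Thm2_cor`). [cite: Shimura1998, §6.1 Corollary of Theorem 2 (p. 41)] -/
theorem avDominatedBy_cmAV_of_isCMTypeRealisation (h₃ : CMAbelianVarietyRealised) {Φ : CMType K}
    {B : AbelianVariety ℂ} {ι : 𝓞 K →+* End B} {θ : K →+* Module.End ℂ (complexBetti B.X 1)}
    (hB : IsCMTypeRealisation Φ B ι θ) : AVDominatedBy B (cmRealisation h₃ (cmCode K Φ)).AV := by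
  have h := avDominatedBy_cmProdAV_zero_of_isCMTypeRealisation (F := K) h₃ shimura1998_Thm3_isogenousPower_and_Thm2_cor.1
    shimura1998_Thm3_isogenousPower_and_Thm2_cor.2 hB
  rwa [cmProdAV_zero] at h

/-- **`A_{(K,Φ̄)} ≼ A_{(K,Φ)}`**: the chosen realisation of `Φ̄`, with its `𝓞_K`-action twisted by complex conjugation,
realises `Φ` (Deligne's remark, `IsCMTypeRealisation.comp_complexConj`), hence is dominated by `A_{(K,Φ)}`.
[cite: Deligne1982HodgeCycles, §5 (b)] [cite: Shimura1998, §6.1 Corollary of Theorem 2 (p. 41)] -/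
theorem avDominatedBy_cmAV_bar (h₃ : CMAbelianVarietyRealised) (Φ : CMType K) :
    AVDominatedBy (cmRealisation h₃ (cmCode K (bar Φ))).AV (cmRealisation h₃ (cmCode K Φ)).AV :=
  avDominatedBy_cmAV_of_isCMTypeRealisation h₃
    ((isCMTypeRealisation_cmCode K h₃ (bar Φ)).comp_complexConj (Φ' := Φ) fun φ => by
      rw [mem_bar_iff]; exact mem_iff_conjugate_notMem Φ φ)

/-- **`A_{(K,Φ)} ≼ A_{(K,Φ^e)}`** for `e : K ≃+* K`, `Φ^e = cmTypeMap e Φ = {s | s ∘ e ∈ Φ}`: the chosen realisation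
of `Φ` with the action twisted by `e⁻¹` realises `Φ^e` (`IsCMTypeRealisation.transport`).
[cite: Deligne1982HodgeCycles, §5 (b)] [cite: Shimura1998, §6.1 Corollary of Theorem 2 (p. 41)] -/
theorem avDominatedBy_cmAV_cmTypeMap (h₃ : CMAbelianVarietyRealised) (Φ : CMType K) (e : K ≃+* K) :
    AVDominatedBy (cmRealisation h₃ (cmCode K Φ)).AV (cmRealisation h₃ (cmCode K (cmTypeMap e Φ))).AV :=
  avDominatedBy_cmAV_of_isCMTypeRealisation h₃ ((isCMTypeRealisation_cmCode K h₃ Φ).transport e)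

/-- **`HC(∏_j A_{(K,Θ_j)})` from factorwise domination by a family with known HC on products**: if every
`A_{(K,Θ_j)}` is dominated by `A (c j)` and `⨁_j A (c j)` satisfies HC, so does `cmProdAV K h₃ n Θ`
(`≅ ⨁_j A_{(K,Θ_j)}`, `AVDominatedBy.biproduct_of_cmProdAV`; `biproduct_map`; `hodgeConjectureFor_of_avDominatedBy`).
[cite: MumfordAV1970, §19] -/
theorem hodgeConjectureFor_cmProdAV_of_forall_avDominatedBy (h₃ : CMAbelianVarietyRealised) {n : ℕ}
    (Θ : Fin (n + 1) → CMType K) {I : Type} (A : I → AbelianVariety ℂ) (c : Fin (n + 1) → I)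
    (hdom : ∀ j, AVDominatedBy (cmRealisation h₃ (cmCode K (Θ j))).AV (A (c j)))
    (hHC : HodgeConjectureFor (⨁ fun j => A (c j)).dim (⨁ fun j => A (c j)).X) :
    HodgeConjectureFor (cmProdAV K h₃ n Θ).dim (cmProdAV K h₃ n Θ).X :=
  hodgeConjectureFor_of_avDominatedBy hHC
    (((AVDominatedBy.refl _).biproduct_of_cmProdAV (F := K)).trans (AVDominatedBy.biproduct_map hdom))

/-- **Reduction to the reference pair.**  With `Θ 0 = {a, b}` and `Ψ = {a, b̄}` (`CMTypeOps.flip b (Θ 0)`), every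
`Θ j` is one of `Θ 0, \overline{Θ 0}, Ψ, Ψ̄` (`type_eq_or_eq_or_eq_or_eq`), so `∏_j A_{(K,Θ_j)} ≼ ⨁_j A_{c j}` for the
reference pair `(A_{Θ 0}, A_Ψ)` and a classifier `c`; hence HC for all products `⨁_j A_{c j}` of the reference pair gives
HC for `∏_j A_{(K,Θ_j)}`. [cite: MumfordAV1970, §19] -/
theorem hodgeConjectureFor_cmProdAV_of_pair (h₃ : CMAbelianVarietyRealised) (h4 : Module.finrank ℚ K = 4) {n : ℕ}
    (Θ : Fin (n + 1) → CMType K) {a b : K →+* ℂ} (hba : b ≠ a) (hba' : b ≠ conjugate a)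
    (hΦ : ∀ s, s ∈ (Θ 0).1 ↔ s = a ∨ s = b)
    (hHC : ∀ c : Fin (n + 1) → Fin 2,
      HodgeConjectureFor (⨁ fun j => (cmRealisation h₃ (cmCode K (![Θ 0, CMTypeOps.flip b (Θ 0)] (c j)))).AV).dim
        (⨁ fun j => (cmRealisation h₃ (cmCode K (![Θ 0, CMTypeOps.flip b (Θ 0)] (c j)))).AV).X) :
    HodgeConjectureFor (cmProdAV K h₃ n Θ).dim (cmProdAV K h₃ n Θ).X := by
  classical
  have hΨ := mem_flip_iff_of_pair h4 hba hba' hΦ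
  set Ψ := CMTypeOps.flip b (Θ 0) with hΨdef
  set F : Fin 2 → CMType K := ![Θ 0, Ψ] with hF
  have hF0 : F 0 = Θ 0 := rfl
  have hF1 : F 1 = Ψ := rfl
  -- distinguishing the two classes
  have hb0 : b ∈ (Θ 0).1 := (hΦ b).2 (Or.inr rfl)
  have hbΨ : b ∉ Ψ.1 := fun h => by
    rcases (hΨ b).1 h with h' | h'
    exacts [hba h', (conjugate_ne b).symm h']
  have hΨ0 : Ψ ≠ Θ 0 := fun h => hbΨ (h ▸ hb0)
  have hΨ0' : Ψ ≠ bar (Θ 0) := fun h => by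
    have ha : a ∈ Ψ.1 := (hΨ a).2 (Or.inl rfl)
    rw [h, mem_bar_iff] at ha
    exact ha ((hΦ a).2 (Or.inl rfl))
  have hΨb0 : bar Ψ ≠ Θ 0 := fun h => by
    have ha : a ∉ (bar Ψ).1 := fun h' => (mem_bar_iff Ψ a).1 h' ((hΨ a).2 (Or.inl rfl))
    exact ha (h ▸ (hΦ a).2 (Or.inl rfl))
  have hΨb0' : bar Ψ ≠ bar (Θ 0) := fun h => by
    have hb : b ∈ (bar Ψ).1 := (mem_bar_iff Ψ b).2 hbΨ
    rw [h, mem_bar_iff] at hb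
    exact hb hb0
  -- the classifier and the factorwise domination
  let c : Fin (n + 1) → Fin 2 := fun j => if Θ j = Θ 0 ∨ Θ j = bar (Θ 0) then 0 else 1
  refine hodgeConjectureFor_cmProdAV_of_forall_avDominatedBy h₃ Θ
    (fun i => (cmRealisation h₃ (cmCode K (F i))).AV) c (fun j => ?_) (hHC c)
  rcases type_eq_or_eq_or_eq_or_eq h4 hba hba' hΦ hΨ (Θ j) with h | h | h | h
  · have hc : c j = 0 := if_pos (Or.inl h)
    rw [hc, hF0, h]
    exact AVDominatedBy.refl _
  · have hc : c j = 0 := if_pos (Or.inr h)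
    rw [hc, hF0, h]
    exact avDominatedBy_cmAV_bar h₃ (Θ 0)
  · have hc : c j = 1 := if_neg (by rw [h]; exact not_or.2 ⟨hΨ0, hΨ0'⟩)
    rw [hc, hF1, h]
    exact AVDominatedBy.refl _
  · have hc : c j = 1 := if_neg (by rw [h]; exact not_or.2 ⟨hΨb0, hΨb0'⟩)
    rw [hc, hF1, h]
    exact avDominatedBy_cmAV_bar h₃ Ψ

/-! ## §3 `K/ℚ` not Galois: the pair family is nondegenerate -/

/-- **HC for `∏_j A_{(K,Θ_j)}` over a NON-GALOIS quartic CM field `K`**, for every finite family `Θ` of CM types of `K`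
and every choice `h₃` of the realisation record — unconditionally: the reference family `(Θ 0, Ψ)` is nondegenerate
(`isNondegenerateFamily_pair_of_not_isGalois`, via the dihedral reflection), so its products satisfy HC
(`Pohlmann1968.IsNondegenerateFamily.hodgeConjectureFor_prod`), and `hodgeConjectureFor_cmProdAV_of_pair`.
[cite: MoonenZarhin1999LowDim, section "Hodge groups of simple abelian surfaces of CM-type"]
[cite: Gordon1999HodgeAVSurvey, 7.5 and 10.10] -/
theorem hodgeConjectureFor_cmProdAV_of_not_isGalois (h₃ : CMAbelianVarietyRealised) (h4 : Module.finrank ℚ K = 4)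
    (hK : ¬IsGalois ℚ K) (n : ℕ) (Θ : Fin (n + 1) → CMType K) :
    HodgeConjectureFor (cmProdAV K h₃ n Θ).dim (cmProdAV K h₃ n Θ).X := by
  obtain ⟨a, b, hba, hba', hΦ⟩ := exists_mem_mem_ne h4 (Θ 0)
  obtain ⟨τ, hτa, hτb⟩ := exists_ringAut_smul_eq_self_smul_eq_conjugate_of_not_isGalois h4 hK hba hba'
  have hnd : IsNondegenerateFamily ![Θ 0, CMTypeOps.flip b (Θ 0)] :=
    isNondegenerateFamily_pair h4 hba hba' hτa hτb hΦ (mem_flip_iff_of_pair h4 hba hba' hΦ)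
  exact hodgeConjectureFor_cmProdAV_of_pair h₃ h4 Θ hba hba' hΦ fun c =>
    hnd.hodgeConjectureFor_prod (fun i => isCMTypeRealisation_cmCode K h₃ (![Θ 0, CMTypeOps.flip b (Θ 0)] i)) c

/-! ## §4 `K/ℚ` Galois with cyclic group: one nondegenerate type and its Galois twists -/

omit [IsCMField K] in
/-- `w ↦ a ∘ w` is injective on `Aut(K)`. [folklore] -/
theorem comp_algEquiv_injective (a : K →+* ℂ) :
    Function.Injective fun w : K ≃ₐ[ℚ] K => a.comp w.toRingEquiv.toRingHom := fun _ _ h =>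
  AlgEquiv.ext fun x => a.injective (RingHom.congr_fun h x)

omit [IsCMField K] in
/-- **For `K/ℚ` Galois every complex embedding is `a ∘ w`, `w ∈ Gal(K/ℚ)`** (`w ↦ a ∘ w` is injective between two sets
of `[K:ℚ]` elements). [folklore] -/
theorem exists_eq_comp_algEquiv [IsGalois ℚ K] (a σ : K →+* ℂ) :
    ∃ w : K ≃ₐ[ℚ] K, σ = a.comp w.toRingEquiv.toRingHom := by
  classical
  have hbij : Function.Bijective fun w : K ≃ₐ[ℚ] K => a.comp w.toRingEquiv.toRingHom := by
    rw [Fintype.bijective_iff_injective_and_card]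
    refine ⟨comp_algEquiv_injective a, ?_⟩
    rw [← Nat.card_eq_fintype_card, IsGalois.card_aut_eq_finrank, Embeddings.card]
  obtain ⟨w, hw⟩ := hbij.2 σ
  exact ⟨w, hw.symm⟩

omit [IsCMField K] in
/-- `(a ∘ w) ∘ x = a ∘ (w x)` (composition of twists). [folklore] -/
theorem comp_algEquiv_comp (a : K →+* ℂ) (w x : K ≃ₐ[ℚ] K) :
    (a.comp w.toRingEquiv.toRingHom).comp x.toRingEquiv.toRingHom = a.comp (w * x).toRingEquiv.toRingHom :=
  RingHom.ext fun _ => rfl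

omit [IsCMField K] in
/-- `τ ∘ (a ∘ w) = (τ ∘ a) ∘ w` for `τ ∈ Aut(ℂ)`. [folklore] -/
theorem smul_comp_algEquiv (τ : ℂ ≃+* ℂ) (a : K →+* ℂ) (w : K ≃ₐ[ℚ] K) :
    τ • a.comp w.toRingEquiv.toRingHom = (τ • a).comp w.toRingEquiv.toRingHom :=
  RingHom.ext fun _ => rfl

/-- **In a cyclic `Gal(K/ℚ)` of order `4`, every `g ∉ {1, c}` has `g² = c`** (`c` is the unique element of order `2`).
[folklore] -/
theorem mul_self_eq_conjGal_of_isCyclic [IsGalois ℚ K] (h4 : Module.finrank ℚ K = 4) (hcyc : IsCyclic (K ≃ₐ[ℚ] K))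
    {g : K ≃ₐ[ℚ] K} (h1 : g ≠ 1) (hc : g ≠ conjGal) : g * g = conjGal := by
  classical
  obtain ⟨r, hr⟩ := IsCyclic.exists_generator (α := K ≃ₐ[ℚ] K)
  have hord : orderOf r = 4 := by
    rw [orderOf_eq_card_of_forall_mem_zpowers hr, IsGalois.card_aut_eq_finrank, h4]
  have hr4 : r ^ 4 = 1 := by rw [← hord, pow_orderOf_eq_one]
  have hr2 : r ^ 2 ≠ 1 := pow_ne_one_of_lt_orderOf (by norm_num) (by rw [hord]; norm_num)
  have hmem : ∀ x : K ≃ₐ[ℚ] K, ∃ k < 4, r ^ k = x := fun x => by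
    have hx := (mem_zpowers_iff_mem_range_orderOf (x := r) (y := x)).1 (hr x)
    rw [hord] at hx
    simpa using hx
  -- `c = r²`
  have hc2 : (conjGal : K ≃ₐ[ℚ] K) = r ^ 2 := by
    obtain ⟨m, hm, hmr⟩ := hmem conjGal
    have hcc : (r ^ m) ^ 2 = 1 := by rw [hmr, pow_two, conjGal_mul_conjGal]
    interval_cases m
    · exact absurd hmr.symm (by
        intro h; have := orderOf_conjGal (K := K); rw [h, pow_zero, orderOf_one] at this; exact absurd this (by norm_num))
    · rw [pow_one] at hcc; exact absurd hcc hr2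
    · exact hmr.symm
    · exfalso; apply hr2
      calc r ^ 2 = r ^ 6 := by rw [show (6 : ℕ) = 4 + 2 from rfl, pow_add, hr4, one_mul]
        _ = 1 := by rw [← pow_mul] at hcc; exact hcc
  obtain ⟨k, hk, rfl⟩ := hmem g
  interval_cases k
  · exact absurd (pow_zero r) h1
  · rw [pow_one, ← pow_two, hc2]
  · exact absurd hc2.symm hc
  · rw [← pow_add, hc2, show (3 + 3 : ℕ) = 4 + 2 from rfl, pow_add, hr4, one_mul]

section Cyclic

variable [IsGalois ℚ K]

/-- **HC for `∏_j A_{(K,Θ_j)}` over a CYCLIC quartic CM field `K`** (Galois with cyclic group), for every finite family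
`Θ` of CM types and every realisation record `h₃` — unconditionally.  With `Θ 0 = {a, b}`, `b = a ∘ g`, `g² = c`: an
automorphism of `ℂ` with `a ↦ b` is a four-cycle (`b ↦ a ∘ g² = ā`), so `Θ 0` is primitive (`isPrimitive_of_fourCycle`),
hence NONDEGENERATE (Ribet, `Pohlmann1968.isNondegenerate_of_isPrimitive_of_finrank_le_six`), and all powers
`A_{Θ 0}^{m}` satisfy HC (`Pohlmann1968.IsNondegenerate.hodgeConjectureFor_pow`); every `Θ j` is `Θ 0`, `\overline{Θ 0}`,
`Ψ = {a, b̄}` or `Ψ̄`, and `A_Ψ ≼ A_{Ψ^{gc}} = A_{Θ 0}` (`Ψ^{gc} ⊇ {a ∘ gc, a ∘ g²c} = {b̄, a}`), so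
`∏_j A_{(K,Θ_j)} ≼ A_{Θ 0}^{n+1}`. [cite: Gordon1999HodgeAVSurvey, 7.5 and 10.10] [cite: Ribet1980, (3.7)]
[cite: Deligne1982HodgeCycles, §5 (b)] -/
theorem hodgeConjectureFor_cmProdAV_of_isGalois_of_isCyclic (h₃ : CMAbelianVarietyRealised)
    (h4 : Module.finrank ℚ K = 4) (hcyc : IsCyclic (K ≃ₐ[ℚ] K)) (n : ℕ) (Θ : Fin (n + 1) → CMType K) :
    HodgeConjectureFor (cmProdAV K h₃ n Θ).dim (cmProdAV K h₃ n Θ).X := by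
  classical
  haveI := isPretransitive_ringEquiv_complex (K := K)
  obtain ⟨a, b, hba, hba', hΦ⟩ := exists_mem_mem_ne h4 (Θ 0)
  -- `b = a ∘ g` with `g² = c`
  obtain ⟨g, hbg⟩ := exists_eq_comp_algEquiv a b
  have hg1 : g ≠ 1 := fun h => hba (by rw [hbg, h]; rfl)
  have hgc : g ≠ conjGal := fun h => hba' (by rw [hbg, h, conjugate_eq_comp_conjGal])
  have hg2 : g * g = conjGal := mul_self_eq_conjGal_of_isCyclic h4 hcyc hg1 hgc
  have hcc : (conjGal : K ≃ₐ[ℚ] K) * conjGal = 1 := conjGal_mul_conjGal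
  have hcg : (conjGal : K ≃ₐ[ℚ] K) * g = g * conjGal := (commute_conjGal g).eq
  -- a four-cycle: `σ a = b`, `σ b = b ∘ g = a ∘ g² = ā`
  obtain ⟨σ, hσ⟩ := MulAction.exists_smul_eq (ℂ ≃+* ℂ) a b
  have hσb : σ • b = conjugate a := by
    rw [hbg, smul_comp_algEquiv, hσ, hbg, comp_algEquiv_comp, hg2, conjugate_eq_comp_conjGal]
  have hnd : IsNondegenerate (Θ 0) :=
    isNondegenerate_of_isPrimitive_of_finrank_le_six (Θ 0) (by rw [h4]; norm_num) a
      (isPrimitive_of_fourCycle h4 hba hba' hσ hσb (Θ 0) hΦ a)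
  -- the flipped type `Ψ = {a, b̄}` and its twist back to `Θ 0`
  have hΨ := mem_flip_iff_of_pair h4 hba hba' hΦ
  set Ψ := CMTypeOps.flip b (Θ 0) with hΨdef
  have hbc : conjugate b = a.comp (g * conjGal).toRingEquiv.toRingHom := by
    rw [conjugate_eq_comp_conjGal b, hbg, comp_algEquiv_comp]
  have htwist : cmTypeMap (g * conjGal).toRingEquiv Ψ = Θ 0 := by
    refine (cmType_eq_of_subset fun s hs => ?_).symm
    rw [mem_cmTypeMap_iff, hΨ]
    rcases (hΦ s).1 hs with rfl | rfl
    · exact Or.inr (by rw [hbc])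
    · refine Or.inl ?_
      rw [hbg, comp_algEquiv_comp, ← mul_assoc, hg2, hcc]
      rfl
  have hΨΦ : AVDominatedBy (cmRealisation h₃ (cmCode K Ψ)).AV (cmRealisation h₃ (cmCode K (Θ 0))).AV := by
    have h := avDominatedBy_cmAV_cmTypeMap h₃ Ψ (g * conjGal).toRingEquiv
    rwa [htwist] at h
  -- every factor is dominated by `A_{Θ 0}`
  refine hodgeConjectureFor_cmProdAV_of_forall_avDominatedBy h₃ Θ
    (fun _ : Fin 1 => (cmRealisation h₃ (cmCode K (Θ 0))).AV) (fun _ => 0) (fun j => ?_)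
    (hnd.hodgeConjectureFor_pow (isCMTypeRealisation_cmCode K h₃ (Θ 0)) (n + 1))
  rcases type_eq_or_eq_or_eq_or_eq h4 hba hba' hΦ hΨ (Θ j) with h | h | h | h <;> rw [h]
  · exact AVDominatedBy.refl _
  · exact avDominatedBy_cmAV_bar h₃ (Θ 0)
  · exact hΨΦ
  · exact (avDominatedBy_cmAV_bar h₃ Ψ).trans hΨΦ

end Cyclic

/-! ## §5 The slice: quartic CM fields with cyclic automorphism group -/

/-- **HC for every `∏_j A_{(K,Θ_j)}` over a quartic CM field `K` with CYCLIC `Aut(K)`** (non-Galois: `Aut(K) = {1,c}`,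
§3; Galois: cyclic `Gal`, §4) — every finite family of CM types, every realisation record, NO hypothesis.
[cite: MoonenZarhin1999LowDim, section "Hodge groups of simple abelian surfaces of CM-type"]
[cite: Gordon1999HodgeAVSurvey, 7.5 and 10.10] -/
theorem hodgeConjectureFor_cmProdAV_quartic_of_isCyclic (h₃ : CMAbelianVarietyRealised) (h4 : Module.finrank ℚ K = 4)
    (hK : IsCyclic (K ≃ₐ[ℚ] K)) (n : ℕ) (Θ : Fin (n + 1) → CMType K) :
    HodgeConjectureFor (cmProdAV K h₃ n Θ).dim (cmProdAV K h₃ n Θ).X := by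
  by_cases hG : IsGalois ℚ K
  · exact hodgeConjectureFor_cmProdAV_of_isGalois_of_isCyclic h₃ h4 hK n Θ
  · exact hodgeConjectureFor_cmProdAV_of_not_isGalois h₃ h4 hG n Θ

/-- **Everything dominated by some `∏_j A_{(K,Θ_j)}` satisfies HC** (`K` quartic CM with cyclic `Aut(K)`): isogeny
factors, powers, products, quotients. [cite: MumfordAV1970, §19] [cite: Gordon1999HodgeAVSurvey, 7.5 and 10.10] -/
theorem hodgeConjectureFor_of_avDominatedBy_cmProdAV_of_isCyclic (h₃ : CMAbelianVarietyRealised)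
    (h4 : Module.finrank ℚ K = 4) (hK : IsCyclic (K ≃ₐ[ℚ] K)) {A : AbelianVariety ℂ} {n : ℕ}
    {Θ : Fin (n + 1) → CMType K} (hA : AVDominatedBy A (cmProdAV K h₃ n Θ)) : HodgeConjectureFor A.dim A.X :=
  hodgeConjectureFor_of_avDominatedBy (hodgeConjectureFor_cmProdAV_quartic_of_isCyclic h₃ h4 hK n Θ) hA

/-- **HC for every complex abelian variety OF CM TYPE whose simple abelian subvarieties have `End⁰ →+* K`**, `K` a
quartic CM field with cyclic `Aut(K)` — UNCONDITIONAL (`Milne1999.IsOfCMType A`, the displayed hypothesis of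
`Theses.RankFourFaces.CMAbelianHodge`; the side condition says: every simple factor is a CM abelian surface with CM by
`K`).  Dimension `0`: the tree's HC in dimension `≤ 3`; positive dimension: seat b30's record-free domination
`CyclicSextic.exists_avDominatedBy_cmProdAV_of_isOfCMType_of_endAlgebra` and §5.
[cite: MoonenZarhin1999LowDim, section "Hodge groups of simple abelian surfaces of CM-type"]
[cite: Shimura1998, §5.1 Propositions 3–6, §6.2 Theorem 3, §7.1 Proposition 7] [cite: MumfordAV1970, §19] -/
theorem hodgeConjectureFor_of_isOfCMType_of_endAlgebra_quartic_of_isCyclic (h4 : Module.finrank ℚ K = 4)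
    (hK : IsCyclic (K ≃ₐ[ℚ] K)) {A : AbelianVariety ℂ} (hCM : IsOfCMType A)
    (hend : ∀ (B : AbelianVariety ℂ) (f : B ⟶ A), IsClosedImmersion (AbelianVariety.Hom.toSchemeHom f) →
      AbelianVariety.IsSimple B → 0 < B.dim → Nonempty (B.endAlgebra →+* K)) :
    HodgeConjectureFor A.dim A.X := by
  rcases Nat.eq_zero_or_pos A.dim with hA0 | hA0
  · exact hodgeConjectureFor_of_dim_le_three_holds (by omega) (AbelianVariety.isSmoothProjective_holds (A := A))
  · obtain ⟨n, Θ, hdom⟩ := exists_avDominatedBy_cmProdAV_of_isOfCMType_of_endAlgebra hA0 hCM hend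
    exact hodgeConjectureFor_of_avDominatedBy_cmProdAV_of_isCyclic cmAbelianVarietyRealised_holds h4 hK hdom

/-- **Everything dominated by such an `A` satisfies HC.** [cite: MumfordAV1970, §19] -/
theorem hodgeConjectureFor_of_avDominatedBy_isOfCMType_quartic_of_isCyclic (h4 : Module.finrank ℚ K = 4)
    (hK : IsCyclic (K ≃ₐ[ℚ] K)) {A C : AbelianVariety ℂ} (hA0 : 0 < A.dim) (hCM : IsOfCMType A)
    (hend : ∀ (B : AbelianVariety ℂ) (f : B ⟶ A), IsClosedImmersion (AbelianVariety.Hom.toSchemeHom f) →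
      AbelianVariety.IsSimple B → 0 < B.dim → Nonempty (B.endAlgebra →+* K))
    (hC : AVDominatedBy C A) : HodgeConjectureFor C.dim C.X := by
  obtain ⟨n, Θ, hdom⟩ := exists_avDominatedBy_cmProdAV_of_isOfCMType_of_endAlgebra hA0 hCM hend
  exact hodgeConjectureFor_of_avDominatedBy_cmProdAV_of_isCyclic cmAbelianVarietyRealised_holds h4 hK (hC.trans hdom)

/-- **`CMAbelianHodge` (= `HC_CM`) restricted to a quartic CM field with cyclic automorphism group, binders VERBATIM,
NO further hypothesis**: with `IsSmoothProjective A.dim A.X` and `∃ S : Subalgebra ℚ A.endAlgebra, IsReduced S ∧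
S commutative ∧ finrank ℚ S = 2 · dim A` written exactly as in `Theses.RankFourFaces.CMAbelianHodge`, plus «every
simple abelian subvariety of positive dimension has `End⁰ →+* K`», the conclusion `HodgeConjectureFor A.dim A.X`
holds. [cite: MoonenZarhin1999LowDim, section "Hodge groups of simple abelian surfaces of CM-type"]
[cite: Gordon1999HodgeAVSurvey, 7.5 and 10.10] -/
theorem cmAbelianHodge_slice_quartic_of_isCyclic (h4 : Module.finrank ℚ K = 4) (hK : IsCyclic (K ≃ₐ[ℚ] K)) :
    ∀ A : AbelianVariety ℂ, IsSmoothProjective A.dim A.X →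
      (∃ S : Subalgebra ℚ A.endAlgebra,
        IsReduced ↥S ∧ (∀ x ∈ S, ∀ y ∈ S, x * y = y * x) ∧ Module.finrank ℚ ↥S = 2 * A.dim) →
      (∀ (B : AbelianVariety ℂ) (f : B ⟶ A), IsClosedImmersion (AbelianVariety.Hom.toSchemeHom f) →
        AbelianVariety.IsSimple B → 0 < B.dim → Nonempty (B.endAlgebra →+* K)) →
      HodgeConjectureFor A.dim A.X :=
  fun _ _ hCM hend => hodgeConjectureFor_of_isOfCMType_of_endAlgebra_quartic_of_isCyclic h4 hK hCM hend

end Summit.HodgeConjecture.CorCM.QuarticCM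

end
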